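import Mathlib.Topology.Instances.ZMod
import Mathlib.Topology.Algebra.Constructions
import Literature.AnabelianGeometry.SemiGraphs.ArithMaximalCompact
import HarnessLib

/-!
# [SemiAnbd] Thm 5.4 (i) as typed (`ArithMaximalCompactStatementI`): a kernel witness that the predicate
# needs `Π_A` non-discrete — TREE-HEALTH record for row T54-3 (observation O-T54-3)

Mochizuki, *Semi-graphs of anabelioids*, Publ. RIMS **42** (2006), §5, Theorem 5.4 (i) p. 66 of the
author's manuscript [cite: MochizukiSemiAnbd2006, Thm 5.4 (i), p. 66]: "Every arithmetically ample compact
subgroup of `π₁^temp(𝔊)` is contained in at least one verticial subgroup. If [it] is contained in more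
than one verticial subgroup, then it is contained in precisely two verticial subgroups, whose intersection
forms an edge-like subgroup."  abc-iut-L3-t3 typed the conclusion as the predicate
`ArithMaximalCompactStatementI D aug` on ARBITRARY data `(D : DecompositionData Gtp V B, aug : Gtp →* PA)`
(`ArithMaximalCompact.lean`, p403878).

PROOF-ONLY-IN-SPIRIT record (one toy `def`, two theorems; wave-4 seat abc-iut-w4-d059, sub-DAG row T54-3
SCOPING, observation O-T54-3): when the augmentation group `Π_A` is DISCRETE — here the one-element group —
the trivial subgroup `⊥` is compact AND arithmetically ample (its image `{1}` is open), lies in every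
verticial subgroup, and clause 2 "precisely two" fails as soon as the data carry three distinct verticial
subgroups; the remaining hypotheses of Thm 5.4 (total arithmetic estrangement, no branch switching) are
vacuous for edgeless data.  In print `Π_A` is the BC-fundamental group of Def 5.1 (ii) — profinite and
infinite in every application — so `⊥` is never arithmetically ample there: the witness says only that a
DISCHARGE of the typed predicate (row T54-3) must carry the side hypothesis `¬ IsArithAmple aug ⊥`
(equivalently: `Π_A` is not discrete), exactly as the geometric Prop 3.6 / Thm 3.7 facts carry `HasVertex`
after the reviewer's vertex-less witness (p405440).  No statement of the paper is contradicted; nothing here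
bears on [IUTchIII] Cor. 3.12.
-/

namespace Literature.AnabelianGeometry.SemiGraphs

namespace ArithMaximalCompactWitness

/-- The toy arithmetic tempered group: the Klein four group `ℤ/2 × ℤ/2` (written multiplicatively),
discrete. [cite: MochizukiSemiAnbd2006, Thm 5.4 (i), p. 66] -/
abbrev G : Type := Multiplicative (ZMod 2 × ZMod 2)

/-- The toy BC-fundamental group `Π_A`: the one-element group. [cite: MochizukiSemiAnbd2006, Def 5.1 (ii), p. 62] -/
abbrev A : Type := Multiplicative (ZMod 1)

/-- The three subgroups of order two of the Klein four group, indexed by `Fin 3`: the "verticial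
subgroups" of the toy data. [cite: MochizukiSemiAnbd2006, Def 5.3 (iii), p. 65] -/
def vert : Fin 3 → Subgroup G :=
  ![Subgroup.zpowers (Multiplicative.ofAdd ((1, 0) : ZMod 2 × ZMod 2)),
    Subgroup.zpowers (Multiplicative.ofAdd ((0, 1) : ZMod 2 × ZMod 2)),
    Subgroup.zpowers (Multiplicative.ofAdd ((1, 1) : ZMod 2 × ZMod 2))]

/-- **The toy decomposition data**: three vertices with the three order-two subgroups as vertex groups,
no branches, no edges (so Def 5.3 (ii) total arithmetic estrangement and "no branch switching" hold
vacuously). [cite: MochizukiSemiAnbd2006, §5, p. 65] -/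
def toyData : DecompositionData G (Fin 3) Empty where
  E := Empty
  edgeOf b := b.elim
  abut b := b.elim
  vertGp := vert
  brGp b := b.elim
  brGp_le_vertGp b := b.elim

/-- In a one-element group every subset is open (it is `∅` or everything). [folklore] -/
private theorem isOpen_of_subsingleton {X : Type*} [TopologicalSpace X] [Subsingleton X] (s : Set X) :
    IsOpen s := by
  rcases s.eq_empty_or_nonempty with h | h
  · rw [h]; exact isOpen_empty
  · rw [Subsingleton.eq_univ_of_nonempty h]; exact isOpen_univ

/-- The generator of `vert i` is not in `vert j` for the three listed pairs: the subgroups are pairwise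
distinct. [folklore] -/
private theorem ofAdd_not_mem_zpowers {a b : ZMod 2 × ZMod 2} (h : ∀ k : ℤ, k • b ≠ a) :
    Multiplicative.ofAdd a ∉ Subgroup.zpowers (Multiplicative.ofAdd b) := by
  rintro ⟨k, hk⟩
  apply h k
  have := congrArg Multiplicative.toAdd hk
  simpa using this

/-- Total arithmetic estrangement holds for the toy data (there are no edges).
[cite: MochizukiSemiAnbd2006, Def 5.3 (ii), p. 65] -/
theorem isTotallyArithEstranged_toy : IsTotallyArithEstranged toyData (1 : G →* A) :=
  fun e => e.elim

/-- **O-T54-3.** `ArithMaximalCompactStatementI` FAILS for the toy data with the one-element `Π_A`: the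
compact, arithmetically ample subgroup `⊥` lies in the three distinct verticial subgroups `vert 0`, `vert 1`,
`vert 2`, contradicting "precisely two". [cite: MochizukiSemiAnbd2006, Thm 5.4 (i), p. 66] -/
theorem not_arithMaximalCompactStatementI_toy :
    ¬ ArithMaximalCompactStatementI toyData (1 : G →* A) := by
  intro h
  have hcpt : IsCompact ((⊥ : Subgroup G) : Set G) := by
    rw [Subgroup.coe_bot]; exact isCompact_singleton
  have hamp : IsArithAmple (1 : G →* A) (⊥ : Subgroup G) := isOpen_of_subsingleton _
  obtain ⟨-, h2⟩ := h ⊥ hcpt hamp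
  -- the three verticial subgroups `vert i = conjSubgroup 1 (vertGp i)`
  have hv : ∀ i : Fin 3, IsVerticial toyData (vert i) := fun i =>
    ⟨i, 1, by ext x; simp [conjSubgroup, toyData]⟩
  -- pairwise distinct
  have h01 : vert 0 ≠ vert 1 := by
    intro he
    have hm : Multiplicative.ofAdd ((1, 0) : ZMod 2 × ZMod 2) ∈ vert 0 := Subgroup.mem_zpowers _
    rw [he] at hm
    exact ofAdd_not_mem_zpowers
      (fun k hk => absurd (by simpa using congrArg Prod.fst hk : (0 : ZMod 2) = 1) (by decide)) hm
  have h20 : vert 2 ≠ vert 0 := by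
    intro he
    have hm : Multiplicative.ofAdd ((1, 1) : ZMod 2 × ZMod 2) ∈ vert 2 := Subgroup.mem_zpowers _
    rw [he] at hm
    exact ofAdd_not_mem_zpowers
      (fun k hk => absurd (by simpa using congrArg Prod.snd hk : (0 : ZMod 2) = 1) (by decide)) hm
  have h21 : vert 2 ≠ vert 1 := by
    intro he
    have hm : Multiplicative.ofAdd ((1, 1) : ZMod 2 × ZMod 2) ∈ vert 2 := Subgroup.mem_zpowers _
    rw [he] at hm
    exact ofAdd_not_mem_zpowers
      (fun k hk => absurd (by simpa using congrArg Prod.fst hk : (0 : ZMod 2) = 1) (by decide)) hm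
  obtain ⟨honly, -⟩ := h2 (vert 0) (vert 1) (hv 0) (hv 1) h01 bot_le bot_le
  rcases honly (vert 2) (hv 2) bot_le with h | h
  · exact h20 h
  · exact h21 h

/-- Hence the typed predicate is not a theorem about ALL data satisfying the (vacuous here) estrangement /
no-switching hypotheses: a discharge must assume `Π_A` non-discrete, e.g. `¬ IsArithAmple aug ⊥`.
[cite: MochizukiSemiAnbd2006, Thm 5.4 (i), p. 66] -/
theorem exists_not_arithMaximalCompactStatementI :
    ∃ (D : DecompositionData G (Fin 3) Empty) (aug : G →* A),
      IsTotallyArithEstranged D aug ∧ IsArithAmple aug (⊥ : Subgroup G) ∧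
        ¬ ArithMaximalCompactStatementI D aug :=
  ⟨toyData, 1, isTotallyArithEstranged_toy, isOpen_of_subsingleton _,
    not_arithMaximalCompactStatementI_toy⟩

end ArithMaximalCompactWitness

end Literature.AnabelianGeometry.SemiGraphs
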